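import Mathlib
import HarnessLib
import Summits.NavierStokesRegularity.NavierStokesRegularity.Theorems.TaylorModelRungThreeCertificateReadoutVStep
import Summits.NavierStokesRegularity.NavierStokesRegularity.Theorems.TaylorModelRungThreeCertificateFormatVInterpW
import Summits.NavierStokesRegularity.NavierStokesRegularity.Theorems.TaylorModelRungThreeCertificateReadouts
import Summits.NavierStokesRegularity.NavierStokesRegularity.Theorems.TaylorModelRungThreeVReadoutsDefs

/-!
# Crux K1b-DR (stmt-NavierStokesRegularity-23954), line `taylor-model` — v3 read-outs, K-SIDE part 5: the read-outs LAYOUT of a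
# v3 certificate (typer g32): how the per-stage read-out input `ROIn` is FILLED from engine-1 g67's `CertTablesV` accessors
# (`nodeVW/coreVW/xD/hD/ωinvB/stageV`, kit `kitOf`, inflation `wT`) and the v1 stage tables (`base.stage j`: `σf`, `γ`, `lev`, `as`,
# `ell/ctr/rad/s/β`, `Lv`, `nx`, `S`, `Λ`, `δ`, `ω`; globals `M`, `mm`, `τs`, `Cb`, `θ`), the per-stage Boolean `checkReadoutStage`
# ((R4) on every sub-step + `readoutStep`), `checkReadouts`, and the READ-OUT RECORD `toReadoutData` (fields `ylo/yhi/Vlo/Vhi`; the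
# tube-growth table `G` and the hull multiple `ΛT` are engine-1's (R1)–(R3) data and enter as parameters)

Definitions only (chosen objects; the closer proves `ReadoutsV` from `checkReadouts = true` with `readoutStep_R5…R11`,
`testR4_sound`, the bridges `inBox_vecF_iff`/`kapp_eq_linF`/`covR_apply`, the ENTRY clause, and `aux_sound` for the surrogates
`A : ReadoutAux QS2` of `…CertificateReadouts`).  Conventions fixed here (cert-1 g3 emits in them): faces `l < nF j` with
`nF j := max (|ell_J|, |β_j|, |ctr_J|, |rad_J|, |s_J|)`, `J := nx j`; PARTNER of face `l` = face `l + n` of ball `j` (row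
`w_{j,l+n} ⊙ D_j`, radius `rad_{j,l+n} + |ℓ_{j,l+n}(yb_j) − ctr_{j,l+n}|↑`; none beyond); polytope box radii `ρ := rB_j`; the
behind-shell surrogate `rlo := (pθ·Cb·r34)↓`, the tail bound `tv := tv↑`; the last sub-step `S j − 1` carries the crossing.

HONEST FRAMING: kernel bookkeeping for the MODEL certificate №23954 (rung TL-M3); nothing here is a statement about the
Navier–Stokes equations, and nothing is asserted.
-/

-- the sub-problem namespace repeats the summit name by design (D-0017)
set_option linter.dupNamespace false

namespace Summit.NavierStokesRegularity.NavierStokesRegularity.Theorems.TaylorModelCert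

open scoped BigOperators
open Literature.Analysis.FluidPDE.TaoCascade Literature.Analysis.FluidPDE.TaoCascade.TaylorChain

namespace CertTablesV

variable (TV : CertTablesV) (kitOf : ℕ → CoreKit) (wT : ℕ → Array Dyad) (A : ReadoutAux QS2)

/-! ### Small builders over the v1 stage tables -/

/-- Enclosure array of a list-coded window covector / vector (`ofQS2` per coordinate). [folklore] -/
def covB (w : List QS2) : Array IntervalD := Array.ofFn fun c : Fin TV.base.n => IntervalD.ofQS2 TV.prec (vget w c)

/-- Hull box of level `l` at node `(j, s)`: `xD ± radLW l`. [folklore] -/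
def hullBox (j : ℕ) (l : Fin 3) (s : ℕ) : Array IntervalD :=
  boxAround TV.base.n (TV.xD j s) (TV.radLW kitOf wT j l (TV.nodeVW kitOf wT j s))

/-- Per-coordinate enclosures of the window bound `M_k` (shell of coordinate `c`). [folklore] -/
def MB : Array IntervalD :=
  Array.ofFn fun c : Fin TV.base.n => IntervalD.ofQS2 TV.prec (vget TV.base.M (c % TV.base.m + 1))

/-- Per-coordinate enclosures of the allowance `Λ_j·δ_j·τs·ω_j(k) + mm`. [folklore] -/
def AB (j : ℕ) : Array IntervalD :=
  let st := TV.base.stage j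
  Array.ofFn fun c : Fin TV.base.n => IntervalD.ofQS2 TV.prec (st.Λ * st.δ * TV.base.τs * TV.base.wgt j c + TV.base.mm)

/-- Number of faces read for stage `j` (target ball `J = nx j`): the longest of the lists involved. [folklore] -/
def nF (j : ℕ) : ℕ :=
  let st := TV.base.stage j
  let sJ := TV.base.stage st.nx
  max (max (max sJ.ell.length st.β.length) (max sJ.ctr.length sJ.rad.length)) sJ.s.length

/-- Face coefficient boxes of ball `J'` (`nF'` rows). [folklore] -/
def faceB (J' nF' : ℕ) : Array (Array IntervalD) :=
  Array.ofFn fun l : Fin nF' => TV.covB ((TV.base.stage J').ell.getD l [])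

/-- Enclosure array of a scalar list (`nF'` entries). [folklore] -/
def listB (v : List QS2) (nF' : ℕ) : Array IntervalD := Array.ofFn fun l : Fin nF' => IntervalD.ofQS2 TV.prec (vget v l)

/-- PARTNER rows of stage `j`: face `l + n` of ball `j` scaled by `D_j` (zero row if there is none). [folklore] -/
def partnerG (j nF' : ℕ) : Array (Array IntervalD) :=
  let st := TV.base.stage j
  Array.ofFn fun l : Fin nF' => Array.ofFn fun c : Fin TV.base.n =>
    if l + TV.base.n < st.ell.length then
      IntervalD.mulR TV.prec (IntervalD.ofQS2 TV.prec (vget (st.ell.getD (l + TV.base.n) []) c))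
        (IntervalD.ofDyad (dget (TV.stageV j).D c))
    else IntervalD.ofInt 0

/-- PARTNER radii `rad_{j,l+n} + |ℓ_{j,l+n}(yb_j) − ctr_{j,l+n}|` (interval; zero if there is none). [folklore] -/
def partnerR (j nF' : ℕ) : Array IntervalD :=
  let st := TV.base.stage j
  let Yb := IntervalD.pointBoxA TV.base.n (TV.stageV j).yb
  Array.ofFn fun l : Fin nF' =>
    if l + TV.base.n < st.ell.length then
      let w := TV.covB (st.ell.getD (l + TV.base.n) [])
      IntervalD.addR TV.prec (IntervalD.ofQS2 TV.prec (vget st.rad (l + TV.base.n)))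
        (IntervalD.ofDyad (IntervalD.mag (IntervalD.subR TV.prec (IntervalD.dotR TV.prec TV.base.n w Yb)
          (IntervalD.ofQS2 TV.prec (vget st.ctr (l + TV.base.n))))))
    else IntervalD.ofInt 0

/-- Behind-shell surrogate `rlo := (pθ·Cb·r34)↓ ≤ 2^(-θ)·Cb·2^(3(Kb+1)/4)` (by `aux_sound`). [folklore] -/
def rlo : Dyad := (IntervalD.ofQS2 TV.prec (A.pθ * TV.base.Cb * A.r34)).lo

/-- Tail surrogate `tv↑ ≥ √(10·Cg·2^(−7(Ka+1)))` (by `aux_sound`). [folklore] -/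
def tvD : Dyad := (IntervalD.ofQS2 TV.prec A.tv).hi

/-! ### The read-out input of stage `j` -/

/-- **The read-out input of stage `j`** (last sub-step `S j − 1`; see the module docstring for the conventions). [folklore] -/
def roIn (j : ℕ) : ROIn :=
  let st := TV.base.stage j
  let S := st.S
  let J := st.nx
  let sJ := TV.base.stage J
  let nF' := TV.nF j
  let N := TV.nodeVW kitOf wT j (S - 1)
  let co := TV.coreVW kitOf wT j (S - 1)
  { coefB := (kitOf j).coefB, mt := (kitOf j).mt, prec := TV.prec, p := TV.base.pdeg, pV := TV.pdegV,
    x := TV.xD j (S - 1), h := TV.hD j (S - 1),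
    H2 := TV.hullBox kitOf wT j 2 (S - 1), H0 := TV.hullBox kitOf wT j 0 (S - 1), H1 := TV.hullBox kitOf wT j 1 (S - 1),
    Ha1 := TV.hullBox kitOf wT j 1 S,
    J := co.J, JU := co.JU, ωinvB := TV.ωinvB j,
    Vc := N.Vc, B := N.B, Z := N.Z,
    Wσ := TV.covB st.σf,
    LB := IntervalD.ofQS2 TV.prec st.lev, GB := IntervalD.ofQS2 TV.prec st.γ, ASB := IntervalD.ofQS2 TV.prec st.as,
    AK := IntervalD.ofQS2 TV.prec (st.Λ * st.δ * TV.base.τs * vget st.ω 0),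
    rlo := TV.rlo A,
    LvB := IntervalD.ofQS2 TV.prec sJ.Lv, tv := TV.tvD A, nF := nF',
    WJ := TV.faceB J nF', G := TV.partnerG j nF',
    ctrB := TV.listB sJ.ctr nF', radB := TV.listB sJ.rad nF', sB := TV.listB sJ.s nF', βB := TV.listB st.β nF',
    rPB := TV.partnerR j nF', ρ := (TV.stageV j).rB }

/-- The read-out step output of stage `j`. [folklore] -/
def roOut (j : ℕ) : ROOut := TV.base.readoutStep (TV.roIn kitOf wT A j)

/-- **Per-stage read-out check**: (R4) on every sub-step and the read-out step of the last one. [folklore] -/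
def checkReadoutStage (j : ℕ) : Bool :=
  allN (TV.base.stage j).S (fun s => TV.base.testR4 TV.MB (TV.AB j) (TV.coreVW kitOf wT j s)) && (TV.roOut kitOf wT A j).ok

/-- **All stages**, plus the surrogate certification. [folklore] -/
def checkReadouts : Bool :=
  TV.base.checkReadoutAux A && allN (TV.base.N₀ + 1) fun j => TV.checkReadoutStage kitOf wT A j

/-! ### The read-out record -/

/-- **The `ReadoutData` record presented by a v3 certificate**: in-step boxes from the read-out step (`ylo/yhi l j`, `l = 0, 1`),
the derivative kernel interval `[Vlo, Vhi] := kerLo/kerHi VB`; the tube-growth table `G` and the hull multiple `ΛT` are the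
(R1)–(R3) data of the composer and are passed through. [folklore] -/
noncomputable def toReadoutData (G : ℕ → ℕ → ℕ → ℝ) (ΛT : ℕ → ℝ) :
    Summit.NavierStokesRegularity.NavierStokesRegularity.Theorems.TaylorModelV.ReadoutData where
  ylo := fun l j => match l with
    | ⟨0, _⟩ => TV.base.vecF (IntervalD.loR (TV.roOut kitOf wT A j).Y0)
    | ⟨_ + 1, _⟩ => TV.base.vecF (IntervalD.loR (TV.roOut kitOf wT A j).Y1)
  yhi := fun l j => match l with
    | ⟨0, _⟩ => TV.base.vecF (IntervalD.hiR (TV.roOut kitOf wT A j).Y0)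
    | ⟨_ + 1, _⟩ => TV.base.vecF (IntervalD.hiR (TV.roOut kitOf wT A j).Y1)
  Vlo := fun j => TV.base.kerLo (TV.roOut kitOf wT A j).VB
  Vhi := fun j => TV.base.kerHi (TV.roOut kitOf wT A j).VB
  G := G
  ΛT := ΛT

end CertTablesV

end Summit.NavierStokesRegularity.NavierStokesRegularity.Theorems.TaylorModelCert
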